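import Summits.HodgeConjecture.HodgeConjecture.Theorems.HeckePrymWeilDeligneWeilFamilyIff
import Summits.HodgeConjecture.HodgeConjecture.Theorems.HeckePrymWeilWeilTwelvefoldsSqrtMinus7OfWeilTransport
import HarnessLib

/-!
# `WeilVariationalHodge` (stmt-HodgeConjecture-14497): the ENGINE-TYPED Weil-transport restatement `WT⁺(p, M)`

Route `HeckePrymWeil`; lead c2 of crux `WeilVariationalHodge`, line `Sketch`; companion of
`HeckePrymWeilWeilVariationalHodgeWeilTransport` (p140177, the Weil transport `WT(p, M)` over arbitrary smooth
proper families).  The ONLY family the route feeds to the transport is Deligne's (`DeligneWeilFamily`,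
stmt-HodgeConjecture-16866), which is H-projective (`𝒳 ↪ ℙᴺ × S` closed) over a smooth irreducible QUASI-PROJECTIVE
base — the hypothesis shape of every printed engine.  So the sharpest restatement of the crux that still closes the
route is `WT⁺(p, M)` = `WT(p, M)` asked only for such families, and the para-abelian quasi-projectivity gap `hqp`
of the line's skeleton never arises.  Certified against the ROUTE DECLS (sorry-free, no new definition, no
named-fact hypothesis): Deligne's global Weil class lemma with the projectivity clauses KEPT (same proof as
`weilFamily_globalWeilClass_of_globalAction`); `HWA(p, k) ⟸` package `+ WT⁺(p, k)`; with the item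
`DeligneWeilFamily`, `∀ p M, WT⁺` gives the sector (consequent of `FamilySectorGlue` verbatim) and the target;
`WT⁺ ⟸ WT ⟸` crux as typed; `WT⁺ ⟸` target alone (tightness); hence GIVEN `DeligneWeilFamily`,
target ⟺ `∀ p M, WT⁺(p, M)` — target-equivalent, Weil-restricted, engine-typed.
-/

noncomputable section

-- every declaration of this problem lives in `Summit.HodgeConjecture.HodgeConjecture.…` (summit = sub-problem)
set_option linter.dupNamespace false

open CategoryTheory AlgebraicGeometry Limits MonoidalCategory CartesianMonoidalCategory

namespace Summit.HodgeConjecture.HodgeConjecture.Theorems.HeckePrymWeilLine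

open Literature.AlgebraicGeometry Literature.AlgebraicGeometry.Motives Literature.AlgebraicGeometry.HodgeTheory
open Literature.AlgebraicTopology.SingularHomology
open Summit.HodgeConjecture.HodgeConjecture.Theses.HeckePrymWeil

/-! ### Deligne's global Weil class, with the projectivity clauses kept -/

/-- **The global Weil class of Deligne's abelian scheme with `K`-action, projectivity clauses kept.**  Same
statement and proof as `weilFamily_globalWeilClass_of_globalAction`, except that the conclusion also records
that the family is H-projective (`𝒳 ↪ ℙᴺ × S` a closed `S`-immersion) and that the smooth irreducible base is
quasi-projective — both are clauses of the package `deligne1982_weilFamily_globalAction` that the original lemma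
discards. [cite: Deligne1982HodgeCycles, proof of Thm. 4.8 (pp. 47–52) with Prop. 4.4, Lemma 4.5, Remark 4.10]
[cite: VoisinHodgeII2003, §3.1.2] -/
theorem weilFamily_globalWeilClass_projective_of_globalAction (hGA : deligne1982_weilFamily_globalAction)
    {p : ℕ} (hp : p.Prime) (hp4 : p % 4 = 3) (hp7 : 7 ≤ p) {k : ℕ} (hk : 1 ≤ k)
    (X : AbelianVariety ℂ) (Φ : X ⟶ X) (hX : X.dim = 2 * k) (hΦ : Φ ≫ Φ = -((p : ℤ) • 𝟙 X))
    (c : complexBetti X.X (2 * k)) (hc : c ∈ weilClassesOf X Φ k p) (hc0 : c ≠ 0)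
    (hrat : IsRationalClass c) (hH : IsOfHodgeType (2 * k) X.X (2 * k) k k c) :
    ∃ (𝒳 S : SchemeOver ℂ) (f : 𝒳 ⟶ S) (s₁ s₀ : ComplexPoints S) (e : X.X ≅ fiberOver f s₁)
      (W : complexBetti 𝒳 (2 * k)),
      IsSmoothProjectiveFamily f (2 * k) ∧
      (∃ (N : ℕ) (ι : 𝒳 ⟶ projectiveSpace N ℂ ⊗ S),
        IsClosedImmersion ι.left ∧ ι ≫ snd (projectiveSpace N ℂ) S = f) ∧
      IrreducibleSpace S.left ∧ AlgebraicGeometry.Smooth S.hom ∧ IsQuasiProjectiveOver S ∧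
      (∀ s : ComplexPoints S, IsRationalClass (complexBetti.map (fiberι f s) (2 * k) W) ∧
        IsOfHodgeType (2 * k) (fiberOver f s) (2 * k) k k (complexBetti.map (fiberι f s) (2 * k) W)) ∧
      (∀ s : ComplexPoints S, ∃ (A' : AbelianVariety ℂ) (φ' : A' ⟶ A') (e' : A'.X ≅ fiberOver f s),
        A'.dim = 2 * k ∧ φ' ≫ φ' = -((p : ℤ) • 𝟙 A') ∧
        complexBetti.map e'.hom (2 * k) (complexBetti.map (fiberι f s) (2 * k) W) ∈ weilClassesOf A' φ' k p) ∧
      complexBetti.map (fiberι f s₁) (2 * k) W = complexBetti.map e.inv (2 * k) c ∧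
      complexBetti.map (fiberι f s₀) (2 * k) W ∈ algebraicClasses (fiberOver f s₀) k := by
  obtain ⟨𝒳, S, f, g, s₁, s₀, e, σ, hfam, hemb, hirr, hsm, hSqp, hg, hfib, he, hσ, hpt, hσ₁, Y, Ψ,
    e₀, ⟨A₁, f₁, g₁, m, hA₁, hY, hΨ, hm, hfg, hf, hg₁⟩, he₀⟩ := hGA p hp hp4 hp7 k hk X Φ hX hΦ c hc hc0 hrat hH
  have hp0 : 0 < p := hp.pos
  -- the base: `S(ℂ)` is a path-connected manifold and `R^{2k} f_* ℂ` is a local system on it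
  haveI := hsm
  haveI := hirr
  haveI : LocallyOfFiniteType S.hom := hSqp.locallyOfFiniteType
  haveI : ConnectedSpace (ComplexPoints S) :=
    (Motives.ComplexPoints.connectedSpace_iff_holds S).2 inferInstance
  obtain ⟨d, hd⟩ := exists_smoothOfRelativeDimension_of_connectedSpace_complexPoints S
  haveI := hd
  haveI := pathConnectedSpace_complexPoints_of_smoothOfRelativeDimension S d
  have hU := isCohomologicallyLocallyTrivialOn_univ_of_isSmoothProjectiveFamily f d hfam hSqp
  -- the fibre maps of `g`
  have hgf' := fun t ↦ exists_fiberHom_comp_fiberι f g hg t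
  choose gf hgf using hgf'
  -- the cohomological Weil plane of the fibre over `t`
  let WP : ∀ t : ComplexPoints S, Submodule ℂ (complexBetti (fiberOver f t) (2 * k)) :=
    fun t ↦
      Submodule.span ℂ
        {x | ∃ w : Fin (2 * k) → complexBetti (fiberOver f t) 1,
          (∀ i, w i ∈ Module.End.eigenspace (complexBetti.map (gf t) 1).hom
            (Complex.I * (Real.sqrt p : ℂ))) ∧
          cupPowOne ℂ (ComplexPoints (fiberOver f t)) (2 * k) w = x} ⊔
      Submodule.span ℂ
        {x | ∃ w : Fin (2 * k) → complexBetti (fiberOver f t) 1,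
          (∀ i, w i ∈ Module.End.eigenspace (complexBetti.map (gf t) 1).hom
            (-(Complex.I * (Real.sqrt p : ℂ)))) ∧
          cupPowOne ℂ (ComplexPoints (fiberOver f t)) (2 * k) w = x}
  -- at `s₁`: `e^{-1 *} c` lies in the Weil plane of `(𝒳_{s₁}, g_{s₁})`
  have hΦ' : Φ ≫ Φ = -(p • 𝟙 X) := by rw [hΦ, natCast_zsmul]
  have he' : e.hom ≫ gf s₁ = Φ.hom.hom.hom ≫ e.hom :=
    hom_comp_fiberHom_eq_of_comp_fiberι f g (hgf s₁) e Φ.hom.hom.hom he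
  have h₁ : complexBetti.map e.inv (2 * k) c ∈ WP s₁ :=
    map_inv_mem_eigenLines_of_mem_weilClassesOf e (gf s₁) hp0 hX hΦ' he' hc
  -- transport from `s₁`: every value of `σ` lies in the Weil plane of its fibre
  have key : ∀ (s t : ComplexPoints S) (hst : (σ s).pt = t), (σ s).clsAt hst ∈ WP t := by
    intro s t hst
    obtain rfl : s = t := (hpt s).symm.trans hst
    let γ : Path (⟨s₁, Set.mem_univ s₁⟩ : (Set.univ : Set (ComplexPoints S))) ⟨s, Set.mem_univ s⟩ :=
      (PathConnectedSpace.somePath s₁ s).map (continuous_id.subtype_mk _)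
    have htr := transportFun_clsAt_of_continuous f (2 * k) hU hσ hpt γ
    have h0 : (σ s₁).clsAt (hpt s₁) = complexBetti.map e.inv (2 * k) c := by
      rw [FiberClass.clsAt_eq_iff]; exact hσ₁
    change transportFun f (2 * k) hU ⟦γ⟧ ((σ s₁).clsAt (hpt s₁)) = (σ s).clsAt (hpt s) at htr
    rw [← htr, h0]
    exact transportFun_mem_eigenLines f hU g hg gf hgf ⟦γ⟧ _ _ (2 * k) h₁
  -- the global class of the section (W-engine, discharged in the tree)
  obtain ⟨W, hWσ⟩ := stub_globalClassOfSection_of_leray deligne1968_invariantClass_fromTotalSpace_holds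
    f (2 * k) (2 * k) hfam hemb hsm hSqp hirr σ hσ hpt
  have hWs : ∀ s : ComplexPoints S, complexBetti.map (fiberι f s) (2 * k) W = (σ s).clsAt (hpt s) := by
    intro s
    symm
    rw [FiberClass.clsAt_eq_iff]
    exact hWσ s
  -- rationality along the section
  have hrat₁ : IsRationalClass (σ s₁).cls := by
    rw [hσ₁]; exact hrat.map _
  have hratσ : ∀ s, IsRationalClass (σ s).cls :=
    stub_rationalAlongSection f (2 * k) (2 * k) hfam hsm hSqp hirr σ hσ hpt s₁ hrat₁
  -- the charts: `W|_{𝒳_s}` read in `A'_s` lies in the strong Weil plane of `(A'_s, φ'_s)`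
  have hchart : ∀ s : ComplexPoints S, ∃ (A' : AbelianVariety ℂ) (φ' : A' ⟶ A') (e' : A'.X ≅ fiberOver f s),
      A'.dim = 2 * k ∧ φ' ≫ φ' = -((p : ℤ) • 𝟙 A') ∧
      complexBetti.map e'.hom (2 * k) (complexBetti.map (fiberι f s) (2 * k) W) ∈ weilClassesOf A' φ' k p ∧
      ∀ w ∈ weilClassesOf A' φ' k p, IsOfHodgeType (2 * k) A'.X (2 * k) k k w := by
    intro s
    obtain ⟨A', φ', e', hA', hφ', he'c, hbal⟩ := hfib s
    have he'' : e'.hom ≫ gf s = φ'.hom.hom.hom ≫ e'.hom :=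
      hom_comp_fiberHom_eq_of_comp_fiberι f g (hgf _) e' φ'.hom.hom.hom he'c
    refine ⟨A', φ', e', hA', hφ', ?_, hbal⟩
    rw [hWs s]
    exact map_mem_weilClassesOf_of_mem_eigenLines e' (gf _) he'' (key s s (hpt s))
  refine ⟨𝒳, S, f, s₁, s₀, e, W, hfam, hemb, hirr, hsm, hSqp, fun s ↦ ⟨?_, ?_⟩, fun s ↦ ?_, ?_, ?_⟩
  · -- rational
    rw [hWs s]
    exact (ras_isRationalClass_clsAt_iff (σ s) (hpt s)).2 (hratσ s)
  · -- Hodge type `(k,k)`: read in the chart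
    obtain ⟨A', φ', e', hA', hφ', hmem, hbal⟩ := hchart s
    have htyp := (hbal _ hmem).map_of_iso e'.symm
    have hid : singularCohomology.map ℂ ℂ (Motives.AlgPoints.mapContinuous (L := ℂ) e'.symm.hom) (2 * k)
        (complexBetti.map e'.hom (2 * k) (complexBetti.map (fiberι f s) (2 * k) W)) =
          complexBetti.map (fiberι f s) (2 * k) W := by
      change complexBetti.map e'.inv (2 * k) (complexBetti.map e'.hom (2 * k) _) = _
      rw [← ModuleCat.comp_apply, ← complexBetti.map_comp, e'.inv_hom_id, complexBetti.map_id]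
      rfl
    rw [hid] at htyp
    exact htyp
  · obtain ⟨A', φ', e', hA', hφ', hmem, -⟩ := hchart s
    exact ⟨A', φ', e', hA', hφ', hmem⟩
  · -- at `s₁`
    rw [hWs s₁, FiberClass.clsAt_eq_iff]
    exact hσ₁
  · -- at `s₀`: the tensor-split fibre is algebraic
    have he₀' : e₀.hom ≫ gf s₀ = Ψ.hom.hom.hom ≫ e₀.hom :=
      hom_comp_fiberHom_eq_of_comp_fiberι f g (hgf s₀) e₀ Ψ.hom.hom.hom he₀
    have hx : complexBetti.map e₀.hom (2 * k) (complexBetti.map (fiberι f s₀) (2 * k) W) ∈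
        weilClassesOf Y Ψ k p := by
      rw [hWs s₀]
      exact map_mem_weilClassesOf_of_mem_eigenLines e₀ (gf s₀) he₀' (key s₀ s₀ (hpt s₀))
    exact owf_isoTransport _ Y e₀ k _
      (owf_anchorAlgebraic hp hp4 hp7 A₁ f₁ g₁ m hA₁ hY hΨ hm hfg hf hg₁ hx)


/-! ### `HWA(p, k)` from Deligne's family and the ENGINE-TYPED Weil transport `WT⁺(p, k)` -/

/-- **`HWA(p, k)` from Deligne's abelian scheme with `K`-action and the engine-typed Weil transport `WT⁺(p, k)`**
(transport asked only along H-projective families over smooth irreducible quasi-projective bases, for global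
classes fibrewise in the Weil planes): take the global Weil class of Deligne's family through `A`
(`weilFamily_globalWeilClass_projective_of_globalAction`), transport from the tensor fibre `s₀` to `s₁`, return
along `e : A ≅ 𝒳_{s₁}` — verbatim the proof of `hodgeWeil_of_weilTransport_of_globalAction`, feeding the two
projectivity clauses to the weaker transport hypothesis.
[cite: Deligne1982HodgeCycles, proof of Thm. 4.8 (pp. 47–52), Lemma 4.5, Remark 4.10] [cite: Grothendieck1966, footnote 13] -/
theorem hodgeWeil_of_weilTransportProj_of_globalAction (hGA : deligne1982_weilFamily_globalAction)
    {p : ℕ} (hp : p.Prime) (hp4 : p % 4 = 3) (hp7 : 7 ≤ p) {k : ℕ} (hk : 1 ≤ k)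
    (hT : ∀ ⦃𝒳 S : SchemeOver ℂ⦄ (f : 𝒳 ⟶ S), IsSmoothProjectiveFamily f (2 * k) →
      (∃ (N : ℕ) (ι : 𝒳 ⟶ projectiveSpace N ℂ ⊗ S),
        IsClosedImmersion ι.left ∧ ι ≫ snd (projectiveSpace N ℂ) S = f) →
      IrreducibleSpace S.left → AlgebraicGeometry.Smooth S.hom →
      (∃ (P : SchemeOver ℂ) (j : S ⟶ P), IsProjectiveOver P ∧ IsOpenImmersion j.left) →
      ∀ (W : complexBetti 𝒳 (2 * k)),
        (∀ s : ComplexPoints S, IsRationalClass (complexBetti.map (fiberι f s) (2 * k) W) ∧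
          IsOfHodgeType (2 * k) (fiberOver f s) (2 * k) k k (complexBetti.map (fiberι f s) (2 * k) W)) →
        (∀ s : ComplexPoints S, ∃ (A' : AbelianVariety ℂ) (φ' : A' ⟶ A') (e' : A'.X ≅ fiberOver f s),
          A'.dim = 2 * k ∧ φ' ≫ φ' = -((p : ℤ) • 𝟙 A') ∧
          complexBetti.map e'.hom (2 * k) (complexBetti.map (fiberι f s) (2 * k) W) ∈
            weilClassesOf A' φ' k p) →
        (∃ s₀ : ComplexPoints S,
          complexBetti.map (fiberι f s₀) (2 * k) W ∈ algebraicClasses (fiberOver f s₀) k) →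
        ∀ s : ComplexPoints S,
          complexBetti.map (fiberι f s) (2 * k) W ∈ algebraicClasses (fiberOver f s) k) :
    ∀ (A : AbelianVariety ℂ) (φ : A ⟶ A), A.dim = 2 * k → φ ≫ φ = -((p : ℤ) • 𝟙 A) →
      ∀ c : complexBetti A.X (2 * k), IsRationalClass c → IsOfHodgeType (2 * k) A.X (2 * k) k k c →
        c ∈ Module.End.eigenspace (complexBetti.map (𝟙 A + φ).hom.hom.hom (2 * k)).hom
              ((1 + Complex.I * (Real.sqrt (p : ℝ) : ℂ)) ^ (2 * k)) ⊔
            Module.End.eigenspace (complexBetti.map (𝟙 A + φ).hom.hom.hom (2 * k)).hom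
              ((1 - Complex.I * (Real.sqrt (p : ℝ) : ℂ)) ^ (2 * k)) →
        c ∈ algebraicClasses A.X k := by
  intro A φ hA hφ c hrat hH hW
  -- the zero class is algebraic
  by_cases h0 : c = 0
  · rw [h0]
    exact Submodule.zero_mem _
  -- typing upgrade: `c` lies in the strong Weil plane of `(A, φ)`
  have hcW := stub_upgrade p hp hp4 hp7 k A φ hA hφ hW
  -- the global Weil class of Deligne's family THROUGH `A`, with its projectivity clauses
  obtain ⟨𝒳, S, f, s₁, s₀, e, W, hfam, hemb, hirr, hsm, hSqp, hfibre, hchart, hW₁, halg₀⟩ :=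
    weilFamily_globalWeilClass_projective_of_globalAction hGA hp hp4 hp7 hk A φ hA hφ c hcW h0 hrat hH
  -- transport to the fibre over `s₁`
  have halg₁ : complexBetti.map (fiberι f s₁) (2 * k) W ∈ algebraicClasses (fiberOver f s₁) k :=
    hT f hfam hemb hirr hsm hSqp W hfibre hchart ⟨s₀, halg₀⟩ s₁
  -- return along `e : A ≅ 𝒳_{s₁}`
  have key := mem_algebraicClasses_map_of_iso (p := k) (hfam.isSmoothProjective s₁)
    (AbelianVariety.isSmoothProjective_holds (A := A)) e halg₁
  rw [hW₁, ← CategoryTheory.comp_apply, ← complexBetti.map_comp, Iso.hom_inv_id,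
    complexBetti.map_id] at key
  exact key

/-! ### Against the route decls -/
/-- **`WT(p, M) → WT⁺(p, M)`** (forget the two projectivity clauses). [cite: Grothendieck1966, footnote 13] -/
theorem weilTransportProjAll_of_weilTransportAll
    (hT : ∀ p : ℕ, p.Prime → p % 4 = 3 → 7 ≤ p → ∀ M : ℕ, 1 ≤ M →
      ∀ ⦃𝒳 S : SchemeOver ℂ⦄ (f : 𝒳 ⟶ S), IsSmoothProjectiveFamily f (2 * M) →
      IrreducibleSpace S.left → AlgebraicGeometry.Smooth S.hom →
      ∀ (W : complexBetti 𝒳 (2 * M)),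
        (∀ s : ComplexPoints S, IsRationalClass (complexBetti.map (fiberι f s) (2 * M) W) ∧
          IsOfHodgeType (2 * M) (fiberOver f s) (2 * M) M M (complexBetti.map (fiberι f s) (2 * M) W)) →
        (∀ s : ComplexPoints S, ∃ (A' : AbelianVariety ℂ) (φ' : A' ⟶ A') (e' : A'.X ≅ fiberOver f s),
          A'.dim = 2 * M ∧ φ' ≫ φ' = -((p : ℤ) • 𝟙 A') ∧
          complexBetti.map e'.hom (2 * M) (complexBetti.map (fiberι f s) (2 * M) W) ∈
            weilClassesOf A' φ' M p) →
        (∃ s₀ : ComplexPoints S,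
          complexBetti.map (fiberι f s₀) (2 * M) W ∈ algebraicClasses (fiberOver f s₀) M) →
        ∀ s : ComplexPoints S,
          complexBetti.map (fiberι f s) (2 * M) W ∈ algebraicClasses (fiberOver f s) M) :
    ∀ p : ℕ, p.Prime → p % 4 = 3 → 7 ≤ p → ∀ M : ℕ, 1 ≤ M →
      ∀ ⦃𝒳 S : SchemeOver ℂ⦄ (f : 𝒳 ⟶ S), IsSmoothProjectiveFamily f (2 * M) →
      (∃ (N : ℕ) (ι : 𝒳 ⟶ projectiveSpace N ℂ ⊗ S),
        IsClosedImmersion ι.left ∧ ι ≫ snd (projectiveSpace N ℂ) S = f) →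
      IrreducibleSpace S.left → AlgebraicGeometry.Smooth S.hom →
      (∃ (P : SchemeOver ℂ) (j : S ⟶ P), IsProjectiveOver P ∧ IsOpenImmersion j.left) →
      ∀ (W : complexBetti 𝒳 (2 * M)),
        (∀ s : ComplexPoints S, IsRationalClass (complexBetti.map (fiberι f s) (2 * M) W) ∧
          IsOfHodgeType (2 * M) (fiberOver f s) (2 * M) M M (complexBetti.map (fiberι f s) (2 * M) W)) →
        (∀ s : ComplexPoints S, ∃ (A' : AbelianVariety ℂ) (φ' : A' ⟶ A') (e' : A'.X ≅ fiberOver f s),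
          A'.dim = 2 * M ∧ φ' ≫ φ' = -((p : ℤ) • 𝟙 A') ∧
          complexBetti.map e'.hom (2 * M) (complexBetti.map (fiberι f s) (2 * M) W) ∈
            weilClassesOf A' φ' M p) →
        (∃ s₀ : ComplexPoints S,
          complexBetti.map (fiberι f s₀) (2 * M) W ∈ algebraicClasses (fiberOver f s₀) M) →
        ∀ s : ComplexPoints S,
          complexBetti.map (fiberι f s) (2 * M) W ∈ algebraicClasses (fiberOver f s) M :=
  fun p hp hp4 hp7 M hM _ _ f hf _ hirr hsm _ => hT p hp hp4 hp7 M hM f hf hirr hsm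

/-- **… and weaker than the crux as typed** (`WeilVariationalHodge → ∀ p M, WT⁺(p, M)`, `weilTransport_of_transport`).
[cite: Grothendieck1966, footnote 13] -/
theorem weilTransportProjAll_of_weilVariationalHodge (hV : WeilVariationalHodge) :
    ∀ p : ℕ, p.Prime → p % 4 = 3 → 7 ≤ p → ∀ M : ℕ, 1 ≤ M →
      ∀ ⦃𝒳 S : SchemeOver ℂ⦄ (f : 𝒳 ⟶ S), IsSmoothProjectiveFamily f (2 * M) →
      (∃ (N : ℕ) (ι : 𝒳 ⟶ projectiveSpace N ℂ ⊗ S),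
        IsClosedImmersion ι.left ∧ ι ≫ snd (projectiveSpace N ℂ) S = f) →
      IrreducibleSpace S.left → AlgebraicGeometry.Smooth S.hom →
      (∃ (P : SchemeOver ℂ) (j : S ⟶ P), IsProjectiveOver P ∧ IsOpenImmersion j.left) →
      ∀ (W : complexBetti 𝒳 (2 * M)),
        (∀ s : ComplexPoints S, IsRationalClass (complexBetti.map (fiberι f s) (2 * M) W) ∧
          IsOfHodgeType (2 * M) (fiberOver f s) (2 * M) M M (complexBetti.map (fiberι f s) (2 * M) W)) →
        (∀ s : ComplexPoints S, ∃ (A' : AbelianVariety ℂ) (φ' : A' ⟶ A') (e' : A'.X ≅ fiberOver f s),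
          A'.dim = 2 * M ∧ φ' ≫ φ' = -((p : ℤ) • 𝟙 A') ∧
          complexBetti.map e'.hom (2 * M) (complexBetti.map (fiberι f s) (2 * M) W) ∈
            weilClassesOf A' φ' M p) →
        (∃ s₀ : ComplexPoints S,
          complexBetti.map (fiberι f s₀) (2 * M) W ∈ algebraicClasses (fiberOver f s₀) M) →
        ∀ s : ComplexPoints S,
          complexBetti.map (fiberι f s) (2 * M) W ∈ algebraicClasses (fiberOver f s) M :=
  fun p hp hp4 hp7 M hM _ _ f hf _ hirr hsm _ => weilTransport_of_transport (hV p hp hp4 hp7 M hM) f hf hirr hsm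

/-- **TIGHTNESS: the target alone gives back the engine-typed Weil transport** (`HodgeWeilLadder → ∀ p M,
WT⁺(p, M)`: ladder + the proved `WeilDescending` ⟹ every rung `HWA(p, M)` ⟹ the conclusion at every fibre,
`weilTransport_of_hodgeWeil`; no family structure, no named fact).
[cite: vanGeemen1994HodgeAV, 4.9] [cite: Fulton1998, §19.1] -/
theorem weilTransportProjAll_of_hodgeWeilLadder (hL : HodgeWeilLadder) :
    ∀ p : ℕ, p.Prime → p % 4 = 3 → 7 ≤ p → ∀ M : ℕ, 1 ≤ M →
      ∀ ⦃𝒳 S : SchemeOver ℂ⦄ (f : 𝒳 ⟶ S), IsSmoothProjectiveFamily f (2 * M) →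
      (∃ (N : ℕ) (ι : 𝒳 ⟶ projectiveSpace N ℂ ⊗ S),
        IsClosedImmersion ι.left ∧ ι ≫ snd (projectiveSpace N ℂ) S = f) →
      IrreducibleSpace S.left → AlgebraicGeometry.Smooth S.hom →
      (∃ (P : SchemeOver ℂ) (j : S ⟶ P), IsProjectiveOver P ∧ IsOpenImmersion j.left) →
      ∀ (W : complexBetti 𝒳 (2 * M)),
        (∀ s : ComplexPoints S, IsRationalClass (complexBetti.map (fiberι f s) (2 * M) W) ∧
          IsOfHodgeType (2 * M) (fiberOver f s) (2 * M) M M (complexBetti.map (fiberι f s) (2 * M) W)) →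
        (∀ s : ComplexPoints S, ∃ (A' : AbelianVariety ℂ) (φ' : A' ⟶ A') (e' : A'.X ≅ fiberOver f s),
          A'.dim = 2 * M ∧ φ' ≫ φ' = -((p : ℤ) • 𝟙 A') ∧
          complexBetti.map e'.hom (2 * M) (complexBetti.map (fiberι f s) (2 * M) W) ∈
            weilClassesOf A' φ' M p) →
        (∃ s₀ : ComplexPoints S,
          complexBetti.map (fiberι f s₀) (2 * M) W ∈ algebraicClasses (fiberOver f s₀) M) →
        ∀ s : ComplexPoints S,
          complexBetti.map (fiberι f s) (2 * M) W ∈ algebraicClasses (fiberOver f s) M := by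
  intro p hp hp4 hp7 M hM 𝒳 S f hf _ hirr hsm _
  refine weilTransport_of_hodgeWeil (p := p) (k := M) ?_ f hf hirr hsm
  -- `HWA(p, M)` for every `M ≥ 1` from the ladder and the proved `WeilDescending`
  exact Theorems.heckePrymWeil_ladder_descent
    (fun n ↦ ∀ (A : AbelianVariety ℂ) (φ : A ⟶ A), A.dim = 2 * n → φ ≫ φ = -((p : ℤ) • 𝟙 A) →
      ∀ c : complexBetti A.X (2 * n), IsRationalClass c → IsOfHodgeType (2 * n) A.X (2 * n) n n c →
        c ∈ Module.End.eigenspace (complexBetti.map (𝟙 A + φ).hom.hom.hom (2 * n)).hom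
              ((1 + Complex.I * (Real.sqrt (p : ℝ) : ℂ)) ^ (2 * n)) ⊔
            Module.End.eigenspace (complexBetti.map (𝟙 A + φ).hom.hom.hom (2 * n)).hom
              ((1 - Complex.I * (Real.sqrt (p : ℝ) : ℂ)) ^ (2 * n)) →
        c ∈ algebraicClasses A.X n)
    ((p - 1) / 2) (by omega) (hL p hp hp4 hp7) (Theorems.weilDescending_proof p hp hp4 hp7) M hM

/-- **The engine-typed restated crux still closes the route's sector glue**: `DeligneWeilFamily →
(∀ p M, WT⁺(p, M)) →` the whole `ℚ(√-p)` Hodge–Weil sector (the consequent of the route decl `FamilySectorGlue`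
verbatim), by `globalAction_of_deligneWeilFamily` and `hodgeWeil_of_weilTransportProj_of_globalAction`.
[cite: Deligne1982HodgeCycles, proof of Thm. 4.8 (pp. 47–52) with Prop. 4.4, Lemma 4.5] [cite: Grothendieck1966, footnote 13] -/
theorem hodgeWeilSector_of_deligneWeilFamily_of_weilTransportProjAll (hF : DeligneWeilFamily)
    (hT : ∀ p : ℕ, p.Prime → p % 4 = 3 → 7 ≤ p → ∀ M : ℕ, 1 ≤ M →
      ∀ ⦃𝒳 S : SchemeOver ℂ⦄ (f : 𝒳 ⟶ S), IsSmoothProjectiveFamily f (2 * M) →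
      (∃ (N : ℕ) (ι : 𝒳 ⟶ projectiveSpace N ℂ ⊗ S),
        IsClosedImmersion ι.left ∧ ι ≫ snd (projectiveSpace N ℂ) S = f) →
      IrreducibleSpace S.left → AlgebraicGeometry.Smooth S.hom →
      (∃ (P : SchemeOver ℂ) (j : S ⟶ P), IsProjectiveOver P ∧ IsOpenImmersion j.left) →
      ∀ (W : complexBetti 𝒳 (2 * M)),
        (∀ s : ComplexPoints S, IsRationalClass (complexBetti.map (fiberι f s) (2 * M) W) ∧
          IsOfHodgeType (2 * M) (fiberOver f s) (2 * M) M M (complexBetti.map (fiberι f s) (2 * M) W)) →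
        (∀ s : ComplexPoints S, ∃ (A' : AbelianVariety ℂ) (φ' : A' ⟶ A') (e' : A'.X ≅ fiberOver f s),
          A'.dim = 2 * M ∧ φ' ≫ φ' = -((p : ℤ) • 𝟙 A') ∧
          complexBetti.map e'.hom (2 * M) (complexBetti.map (fiberι f s) (2 * M) W) ∈
            weilClassesOf A' φ' M p) →
        (∃ s₀ : ComplexPoints S,
          complexBetti.map (fiberι f s₀) (2 * M) W ∈ algebraicClasses (fiberOver f s₀) M) →
        ∀ s : ComplexPoints S,
          complexBetti.map (fiberι f s) (2 * M) W ∈ algebraicClasses (fiberOver f s) M) :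
    ∀ p : ℕ, p.Prime → p % 4 = 3 → 7 ≤ p → ∀ n : ℕ, 1 ≤ n →
      ∀ (A : AbelianVariety ℂ) (φ : A ⟶ A), A.dim = 2 * n → φ ≫ φ = -((p : ℤ) • 𝟙 A) →
        ∀ c : complexBetti A.X (2 * n), IsRationalClass c → IsOfHodgeType (2 * n) A.X (2 * n) n n c →
          c ∈ Module.End.eigenspace (complexBetti.map (𝟙 A + φ).hom.hom.hom (2 * n)).hom
                ((1 + Complex.I * (Real.sqrt (p : ℝ) : ℂ)) ^ (2 * n)) ⊔
              Module.End.eigenspace (complexBetti.map (𝟙 A + φ).hom.hom.hom (2 * n)).hom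
                ((1 - Complex.I * (Real.sqrt (p : ℝ) : ℂ)) ^ (2 * n)) →
          c ∈ algebraicClasses A.X n := by
  intro p hp hp4 hp7 n hn
  exact hodgeWeil_of_weilTransportProj_of_globalAction (globalAction_of_deligneWeilFamily hF) hp hp4 hp7 hn
    (hT p hp hp4 hp7 n hn)

/-- **The route TARGET from the route item `DeligneWeilFamily` and the engine-typed restated crux**
(`HodgeWeilLadder`, stmt-HodgeConjecture-1259; rung `(p, g)` is `HWA(p, (p-1)/2·(g-1))`, `(p-1)/2·(g-1) ≥ 3`).
[cite: Deligne1982HodgeCycles, proof of Thm. 4.8] [cite: Grothendieck1966, footnote 13] -/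
theorem hodgeWeilLadder_of_deligneWeilFamily_of_weilTransportProjAll (hF : DeligneWeilFamily)
    (hT : ∀ p : ℕ, p.Prime → p % 4 = 3 → 7 ≤ p → ∀ M : ℕ, 1 ≤ M →
      ∀ ⦃𝒳 S : SchemeOver ℂ⦄ (f : 𝒳 ⟶ S), IsSmoothProjectiveFamily f (2 * M) →
      (∃ (N : ℕ) (ι : 𝒳 ⟶ projectiveSpace N ℂ ⊗ S),
        IsClosedImmersion ι.left ∧ ι ≫ snd (projectiveSpace N ℂ) S = f) →
      IrreducibleSpace S.left → AlgebraicGeometry.Smooth S.hom →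
      (∃ (P : SchemeOver ℂ) (j : S ⟶ P), IsProjectiveOver P ∧ IsOpenImmersion j.left) →
      ∀ (W : complexBetti 𝒳 (2 * M)),
        (∀ s : ComplexPoints S, IsRationalClass (complexBetti.map (fiberι f s) (2 * M) W) ∧
          IsOfHodgeType (2 * M) (fiberOver f s) (2 * M) M M (complexBetti.map (fiberι f s) (2 * M) W)) →
        (∀ s : ComplexPoints S, ∃ (A' : AbelianVariety ℂ) (φ' : A' ⟶ A') (e' : A'.X ≅ fiberOver f s),
          A'.dim = 2 * M ∧ φ' ≫ φ' = -((p : ℤ) • 𝟙 A') ∧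
          complexBetti.map e'.hom (2 * M) (complexBetti.map (fiberι f s) (2 * M) W) ∈
            weilClassesOf A' φ' M p) →
        (∃ s₀ : ComplexPoints S,
          complexBetti.map (fiberι f s₀) (2 * M) W ∈ algebraicClasses (fiberOver f s₀) M) →
        ∀ s : ComplexPoints S,
          complexBetti.map (fiberι f s) (2 * M) W ∈ algebraicClasses (fiberOver f s) M) :
    HodgeWeilLadder := by
  intro p hp hp4 hp7 g hg n hn A φ hA hφ c hrat hH hW
  have hn1 : 1 ≤ n := by have := owf_three_le_k hp7 hg hn; omega
  exact hodgeWeilSector_of_deligneWeilFamily_of_weilTransportProjAll hF hT p hp hp4 hp7 n hn1 A φ hA hφ c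
    hrat hH hW

/-- **GIVEN the route item `DeligneWeilFamily`, the route target `HodgeWeilLadder` is EQUIVALENT to the
engine-typed Weil-transport restatement `∀ p M, WT⁺(p, M)` of the crux** — the recommended restatement of
stmt-HodgeConjecture-14497: Weil-restricted, typed in the hypotheses of the printed engines and of Deligne's
family, target-equivalent. [cite: Deligne1982HodgeCycles, proof of Thm. 4.8] [cite: Grothendieck1966, footnote 13] -/
theorem hodgeWeilLadder_iff_weilTransportProjAll_of_deligneWeilFamily (hF : DeligneWeilFamily) :
    HodgeWeilLadder ↔
    ∀ p : ℕ, p.Prime → p % 4 = 3 → 7 ≤ p → ∀ M : ℕ, 1 ≤ M →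
      ∀ ⦃𝒳 S : SchemeOver ℂ⦄ (f : 𝒳 ⟶ S), IsSmoothProjectiveFamily f (2 * M) →
      (∃ (N : ℕ) (ι : 𝒳 ⟶ projectiveSpace N ℂ ⊗ S),
        IsClosedImmersion ι.left ∧ ι ≫ snd (projectiveSpace N ℂ) S = f) →
      IrreducibleSpace S.left → AlgebraicGeometry.Smooth S.hom →
      (∃ (P : SchemeOver ℂ) (j : S ⟶ P), IsProjectiveOver P ∧ IsOpenImmersion j.left) →
      ∀ (W : complexBetti 𝒳 (2 * M)),
        (∀ s : ComplexPoints S, IsRationalClass (complexBetti.map (fiberι f s) (2 * M) W) ∧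
          IsOfHodgeType (2 * M) (fiberOver f s) (2 * M) M M (complexBetti.map (fiberι f s) (2 * M) W)) →
        (∀ s : ComplexPoints S, ∃ (A' : AbelianVariety ℂ) (φ' : A' ⟶ A') (e' : A'.X ≅ fiberOver f s),
          A'.dim = 2 * M ∧ φ' ≫ φ' = -((p : ℤ) • 𝟙 A') ∧
          complexBetti.map e'.hom (2 * M) (complexBetti.map (fiberι f s) (2 * M) W) ∈
            weilClassesOf A' φ' M p) →
        (∃ s₀ : ComplexPoints S,
          complexBetti.map (fiberι f s₀) (2 * M) W ∈ algebraicClasses (fiberOver f s₀) M) →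
        ∀ s : ComplexPoints S,
          complexBetti.map (fiberι f s) (2 * M) W ∈ algebraicClasses (fiberOver f s) M :=
  ⟨weilTransportProjAll_of_hodgeWeilLadder, hodgeWeilLadder_of_deligneWeilFamily_of_weilTransportProjAll hF⟩

end Summit.HodgeConjecture.HodgeConjecture.Theorems.HeckePrymWeilLine

end
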